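import Mathlib
import Summits.ResolutionOfSingularities.ResolutionOfSingularities.Theorems.HomologicalConductorPersistenceDoubleDoubleCoverCentre
import Literature.AlgebraicGeometry.Resolution.AlterationsSemiStableCodimTwoBlowupFibreModels
import Summits.ResolutionOfSingularities.ResolutionOfSingularities.Theorems.HomologicalConductorPersistenceFaithfullyFlatDescentCompletion
import HarnessLib

/-!
# K-C3 §H2L piece K2c: the completed local ring of `u² + v² = h(z,t)` at the origin IS the iterated double
# cover `k⟦z,t⟧⟦u⟧⟦v⟧/(−h + u² + v²)`, and the K2-LOWER BOUND at the algebraic local ring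

Route `ResolutionOfSingularities/HomologicalConductor`, chain W4.4b (cell `res-hironaka`), crux `Persistence`
(stmt-ResolutionOfSingularities-16484), KILL CANDIDATE K-C3 (res-L1-w44b-plan-1 CHAIN v13.3 ASSIGN v1.9 «011: K2c»).
[OURS; AI-written, weaker than expert review; NOT a statement of the manuscript under study (Hironaka 2017), and no statement of
that manuscript is used.]

Coordinates: `P = k[z,t,u,v] = MvPolynomial (Fin 4) k` (indices `0,1,2,3`), a plane-curve polynomial `hP ∈ k[z,t]` with
`hP(0) = 0`, the surface-times-nothing… the THREEFOLD `A′ = P/(u² + v² − hP)` and its origin `𝔬′ = (z,t,u,v)·A′`.  For the chain's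
`xy − h` one substitutes `x = u + iv`, `y = u − iv` (`i² = −1`, `char ≠ 2`): a LINEAR isomorphism of polynomial rings under
which the centre `(x, y, z², zt, t²)` of K-C3 corresponds to `(u, v, z², zt, t²)` — no square root of `−1` is used in this file.

* `exists_nestingEquiv` — the NESTING isomorphism `N : k⟦z,t,u,v⟧ ≃+* k⟦z,t⟧⟦u⟧⟦v⟧` (tree `MvPowerSeriesNested.nestedEquiv` twice
  + `MvPowerSeries.renameEquiv`) with `N v = v`, `N u = C u`, `N z = C C z`, `N t = C C t` and `N(p(z,t)) = C C p` for every
  polynomial `p ∈ k[z,t]`;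
* `exists_ringEquiv_completion` — **K2c-iso**: for ANY local ring `L` of `A′` at `𝔬′` (`IsLocalization.AtPrime L 𝔬′`), an
  isomorphism `e : L^ ≃+* T_{−h} := BranchedCover (k⟦z,t⟧⟦u⟧) (C (−h) + v²) 2 = k⟦z,t⟧⟦u⟧⟦v⟧/(−h + u² + v²)` (`h = ↑hP`) sending the
  images of `z, t, u, v` to `(CC z)‾, (CC t)‾, (C u)‾ = ū, v̄` — the tree's node template
  (`adicCompletionEquivOfIsLocalizationAtMaximal`, `quotientCompletionEquiv` = Matsumura 8.11, Mathlib's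
  `MvPowerSeries.toAdicCompletionAlgEquiv`) in four variables, followed by the nesting isomorphism;
* **`span_le_cohomologyAnnihilator_of_isLocalization`** — **K2-LOWER AT THE ALGEBRAIC LOCAL RING**: modulo the named fact
  [Esentepe2020, Thm. 5.4] (`hE`) and the curve-side identity `hca : ca(k⟦z,t⟧/(h)) = (z,t)²·(k⟦z,t⟧/(h))` (Esentepe 4.4 + the
  conductor; K2b), **`(u, v, z², zt, t²)·L ≤ ca(L)`** — by FAITHFULLY FLAT DESCENT along `L → L^` (PROVED in the tree:
  `comap_cohomologyAnnihilator_le_of_faithfullyFlat'`, `faithfullyFlat_adicCompletion`, p512917), the isomorphism `e`, and part 4b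
  (`cohomologyAnnihilator_doubleDoubleCover_planeCurve_neg_eq_span_sup_span`, p528980).

Filed `--supports stmt-ResolutionOfSingularities-16484 --as helper`.  References: Ö. Esentepe, J. Algebra 541 (2020) [`Esentepe2020`];
H. Matsumura, *Commutative Ring Theory*, Thm. 8.11 [`Matsumura1987`] — via the tree.
-/

noncomputable section

-- single-problem summit: the doubled namespace component `ResolutionOfSingularities` is forced
set_option linter.dupNamespace false

namespace Summit.ResolutionOfSingularities.ResolutionOfSingularities.Theorems.HomologicalConductor.PersistenceKC3Completion

open IsLocalRing Literature.RingTheory.CohomologyAnnihilator Literature.AlgebraicGeometry.Resolution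
open Summit.ResolutionOfSingularities.ResolutionOfSingularities.Theorems.HomologicalConductor.PersistenceFaithfullyFlatDescentCompletion
open Summit.ResolutionOfSingularities.ResolutionOfSingularities.Theorems.HomologicalConductor.PersistenceBranchedCoverIterate
open Summit.ResolutionOfSingularities.ResolutionOfSingularities.Theorems.HomologicalConductor.PersistenceDoubleDoubleCoverCentre

universe u

/-! ## The nesting isomorphism `k⟦z,t,u,v⟧ ≅ k⟦z,t⟧⟦u⟧⟦v⟧` -/

/-- The inclusion of indices `Fin 2 → Fin 4`, `0 ↦ 0` (`z`), `1 ↦ 1` (`t`). -/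
def zt : Fin 2 → Fin 4 := Fin.castLE (by norm_num)

/-- **NESTING**: a ring isomorphism `N : k⟦z,t,u,v⟧ ≃+* k⟦z,t⟧⟦u⟧⟦v⟧` (`MvPowerSeries (Fin 4) k ≃+*
PowerSeries (PowerSeries (MvPowerSeries (Fin 2) k))`) with `N v = v` (the outer variable), `N u = C u`, `N z = C (C z)`,
`N t = C (C t)`, and `N (p(z,t)) = C (C p)` for every polynomial `p ∈ k[z,t]` (renaming `Fin 4 ≃ Unit ⊕ (Unit ⊕ Fin 2)` and the
tree's `MvPowerSeriesNested.nestedEquiv` twice). [folklore] -/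
theorem exists_nestingEquiv (k : Type u) [Field k] :
    ∃ N : MvPowerSeries (Fin 4) k ≃+* PowerSeries (PowerSeries (MvPowerSeries (Fin 2) k)),
      N (MvPowerSeries.X 3) = PowerSeries.X ∧
      N (MvPowerSeries.X 2) = PowerSeries.C PowerSeries.X ∧
      N (MvPowerSeries.X 0) = PowerSeries.C (PowerSeries.C (MvPowerSeries.X 0)) ∧
      N (MvPowerSeries.X 1) = PowerSeries.C (PowerSeries.C (MvPowerSeries.X 1)) ∧
      ∀ p : MvPolynomial (Fin 2) k,
        N ((MvPolynomial.rename zt p : MvPolynomial (Fin 4) k) : MvPowerSeries (Fin 4) k) =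
          PowerSeries.C (PowerSeries.C (p : MvPowerSeries (Fin 2) k)) := by
  classical
  -- the reindexing `Fin 4 ≃ Unit ⊕ (Unit ⊕ Fin 2)`: `3 ↦ inl`, `2 ↦ inr inl`, `0,1 ↦ inr inr`
  let ε : Fin 4 ≃ Unit ⊕ (Unit ⊕ Fin 2) :=
    { toFun := ![Sum.inr (Sum.inr 0), Sum.inr (Sum.inr 1), Sum.inr (Sum.inl ()), Sum.inl ()]
      invFun := fun s => Sum.elim (fun _ => 3) (Sum.elim (fun _ => 2) zt) s
      left_inv := fun i => by fin_cases i <;> rfl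
      right_inv := fun s => by
        rcases s with ⟨⟨⟩⟩ | ⟨⟨⟩⟩ | i
        · rfl
        · rfl
        · fin_cases i <;> rfl }
  -- the power-series map equivalence along the inner nesting
  let e₂ : MvPowerSeries (Unit ⊕ Fin 2) k ≃+* PowerSeries (MvPowerSeries (Fin 2) k) :=
    MvPowerSeriesNested.nestedEquiv Unit (Fin 2) k
  let Pe : PowerSeries (MvPowerSeries (Unit ⊕ Fin 2) k) ≃+* PowerSeries (PowerSeries (MvPowerSeries (Fin 2) k)) :=
    RingEquiv.ofRingHom (PowerSeries.map (e₂ : MvPowerSeries (Unit ⊕ Fin 2) k →+* _))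
      (PowerSeries.map (e₂.symm : _ →+* MvPowerSeries (Unit ⊕ Fin 2) k))
      (by rw [← PowerSeries.map_comp, RingEquiv.comp_symm]; exact RingHom.ext (congrFun PowerSeries.map_id))
      (by rw [← PowerSeries.map_comp, RingEquiv.symm_comp]; exact RingHom.ext (congrFun PowerSeries.map_id))
  have hPe : ∀ a, Pe a = PowerSeries.map (e₂ : MvPowerSeries (Unit ⊕ Fin 2) k →+* _) a := fun a => rfl
  let e₁ : MvPowerSeries (Unit ⊕ (Unit ⊕ Fin 2)) k ≃+* PowerSeries (MvPowerSeries (Unit ⊕ Fin 2) k) :=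
    MvPowerSeriesNested.nestedEquiv Unit (Unit ⊕ Fin 2) k
  let N : MvPowerSeries (Fin 4) k ≃+* PowerSeries (PowerSeries (MvPowerSeries (Fin 2) k)) :=
    ((MvPowerSeries.renameEquiv k ε).toRingEquiv.trans e₁).trans Pe
  have hN : ∀ a, N a = Pe (e₁ (MvPowerSeries.rename ε a)) := fun a => rfl
  have hX : ∀ i : Fin 4, N (MvPowerSeries.X i) = Pe (e₁ (MvPowerSeries.X (ε i))) := fun i => by
    rw [hN, MvPowerSeries.rename_X]
  have hε3 : ε 3 = Sum.inl () := rfl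
  have hε2 : ε 2 = Sum.inr (Sum.inl ()) := rfl
  have hε0 : ε 0 = Sum.inr (Sum.inr 0) := rfl
  have hε1 : ε 1 = Sum.inr (Sum.inr 1) := rfl
  have h3 : N (MvPowerSeries.X 3) = PowerSeries.X := by
    rw [hX, hε3, MvPowerSeriesNested.nestedEquiv_X_inl, hPe]
    exact PowerSeries.map_X _
  have h2 : N (MvPowerSeries.X 2) = PowerSeries.C PowerSeries.X := by
    rw [hX, hε2, MvPowerSeriesNested.nestedEquiv_X_inr, hPe]
    change PowerSeries.map _ (PowerSeries.C _) = _
    rw [PowerSeries.map_C]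
    change PowerSeries.C (e₂ (MvPowerSeries.X (Sum.inl ()))) = _
    rw [MvPowerSeriesNested.nestedEquiv_X_inl]
    rfl
  have hzt : ∀ j : Fin 2, N (MvPowerSeries.X (zt j)) =
      PowerSeries.C (PowerSeries.C (MvPowerSeries.X j)) := fun j => by
    have hεj : ε (zt j) = Sum.inr (Sum.inr j) := by fin_cases j <;> rfl
    rw [hX, hεj, MvPowerSeriesNested.nestedEquiv_X_inr, hPe]
    change PowerSeries.map _ (PowerSeries.C _) = _
    rw [PowerSeries.map_C]
    change PowerSeries.C (e₂ (MvPowerSeries.X (Sum.inr j))) = _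
    rw [MvPowerSeriesNested.nestedEquiv_X_inr]
    rfl
  have hC : ∀ a : k, N (MvPowerSeries.C a) = PowerSeries.C (PowerSeries.C (MvPowerSeries.C a)) := fun a => by
    rw [hN, MvPowerSeries.rename_C, MvPowerSeriesNested.nestedEquiv_C, hPe]
    change PowerSeries.map _ (PowerSeries.C _) = _
    rw [PowerSeries.map_C]
    change PowerSeries.C (e₂ (MvPowerSeries.C a)) = _
    rw [MvPowerSeriesNested.nestedEquiv_C]
    rfl
  refine ⟨N, h3, h2, hzt 0, hzt 1, fun p => ?_⟩
  -- two ring maps `k[z,t] → k⟦z,t⟧⟦u⟧⟦v⟧` agreeing on `C a` and `X j`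
  have key : (N : MvPowerSeries (Fin 4) k →+* _).comp
      (MvPolynomial.coeToMvPowerSeries.ringHom.comp (MvPolynomial.rename zt).toRingHom) =
      (PowerSeries.C (R := PowerSeries (MvPowerSeries (Fin 2) k))).comp
        ((PowerSeries.C (R := MvPowerSeries (Fin 2) k)).comp
          (MvPolynomial.coeToMvPowerSeries.ringHom (σ := Fin 2) (R := k))) := by
    refine MvPolynomial.ringHom_ext (fun a => ?_) (fun j => ?_)
    · simp only [RingHom.comp_apply, AlgHom.toRingHom_eq_coe, RingHom.coe_coe, MvPolynomial.rename_C,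
        MvPolynomial.coeToMvPowerSeries.ringHom_apply, MvPolynomial.coe_C]
      exact hC a
    · simp only [RingHom.comp_apply, AlgHom.toRingHom_eq_coe, RingHom.coe_coe, MvPolynomial.rename_X,
        MvPolynomial.coeToMvPowerSeries.ringHom_apply, MvPolynomial.coe_X]
      exact hzt j
  have := congrArg (fun φ => φ p) key
  simpa only [RingHom.comp_apply, AlgHom.toRingHom_eq_coe, RingHom.coe_coe,
    MvPolynomial.coeToMvPowerSeries.ringHom_apply] using this

/-! ## The threefold `u² + v² = h(z,t)` and its origin -/

section Setup

variable (k : Type u) [Field k] (hP : MvPolynomial (Fin 2) k)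

/-- The polynomial `u² + v² − h(z,t) ∈ k[z,t,u,v]` (`h = hP` renamed into the first two of four variables). -/
def kc3Poly : MvPolynomial (Fin 4) k :=
  MvPolynomial.X 2 ^ 2 + MvPolynomial.X 3 ^ 2 - MvPolynomial.rename zt hP

/-- The threefold `A′ = k[z,t,u,v]/(u² + v² − h)`. -/
abbrev KC3Ring : Type u := MvPolynomial (Fin 4) k ⧸ Ideal.span {kc3Poly k hP}

/-- Its origin `𝔬′ = (z, t, u, v)·A′`. -/
def kc3Origin : Ideal (KC3Ring k hP) :=
  (originIdeal k 4).map (Ideal.Quotient.mk (Ideal.span {kc3Poly k hP}))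

variable {k hP}

/-- `u² + v² − h` vanishes at the origin when `h` does. [folklore] -/
theorem kc3Poly_mem_originIdeal (h0 : MvPolynomial.constantCoeff hP = 0) : kc3Poly k hP ∈ originIdeal k 4 := by
  rw [mem_originIdeal_iff, kc3Poly, map_sub, map_add, map_pow, map_pow, MvPolynomial.constantCoeff_X,
    MvPolynomial.constantCoeff_X, MvPolynomial.constantCoeff_rename, h0]
  norm_num

/-- The origin of `A′` is a maximal ideal. [folklore] -/
theorem kc3Origin_isMaximal (h0 : MvPolynomial.constantCoeff hP = 0) : (kc3Origin k hP).IsMaximal := by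
  rcases Ideal.map_eq_top_or_isMaximal_of_surjective (Ideal.Quotient.mk (Ideal.span {kc3Poly k hP}))
    Ideal.Quotient.mk_surjective (originIdeal.isMaximal k 4) with h | h
  · exfalso
    have hc := congrArg (Ideal.comap (Ideal.Quotient.mk (Ideal.span {kc3Poly k hP}))) h
    rw [Ideal.comap_map_of_surjective _ Ideal.Quotient.mk_surjective, Ideal.comap_top, ← RingHom.ker_eq_comap_bot,
      Ideal.mk_ker, sup_eq_left.mpr ((Ideal.span_singleton_le_iff_mem _).mpr (kc3Poly_mem_originIdeal h0))] at hc
    exact (originIdeal.isMaximal k 4).ne_top hc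
  · exact h

/-- The nested image of `u² + v² − h` is the generator `C (C (−h) + u²) + v²` of the iterated double cover `T_{−h}`. [folklore] -/
theorem nesting_kc3Poly (N : MvPowerSeries (Fin 4) k ≃+* PowerSeries (PowerSeries (MvPowerSeries (Fin 2) k)))
    (hN3 : N (MvPowerSeries.X 3) = PowerSeries.X) (hN2 : N (MvPowerSeries.X 2) = PowerSeries.C PowerSeries.X)
    (hNp : ∀ p : MvPolynomial (Fin 2) k,
      N ((MvPolynomial.rename zt p : MvPolynomial (Fin 4) k) : MvPowerSeries (Fin 4) k) =
        PowerSeries.C (PowerSeries.C (p : MvPowerSeries (Fin 2) k))) :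
    N (kc3Poly k hP : MvPowerSeries (Fin 4) k) =
      PowerSeries.C (PowerSeries.C (-(hP : MvPowerSeries (Fin 2) k)) + PowerSeries.X ^ 2) + PowerSeries.X ^ 2 := by
  have hc : ((kc3Poly k hP : MvPolynomial (Fin 4) k) : MvPowerSeries (Fin 4) k) =
      MvPowerSeries.X 2 ^ 2 + MvPowerSeries.X 3 ^ 2 -
        ((MvPolynomial.rename zt hP : MvPolynomial (Fin 4) k) : MvPowerSeries (Fin 4) k) := by
    rw [kc3Poly, ← MvPolynomial.coeToMvPowerSeries.ringHom_apply, map_sub, map_add, map_pow, map_pow]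
    simp only [MvPolynomial.coeToMvPowerSeries.ringHom_apply, MvPolynomial.coe_X]
  rw [hc, map_sub, map_add, map_pow, map_pow, hN3, hN2, hNp, map_add, map_pow, map_neg, map_neg]
  ring

end Setup

/-! ## K2c-iso: the completed local ring at the origin is the iterated double cover -/

/-- **K2c-iso [OURS]: the `𝔪`-adic completion of ANY local ring `L` of `A′ = k[z,t,u,v]/(u² + v² − h)` at the origin is the
iterated double cover `T_{−h} = k⟦z,t⟧⟦u⟧⟦v⟧/(−h + u² + v²)`** (`h = ↑hP`, `hP(0) = 0`), by an isomorphism sending the images of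
`z, t, u, v` to `(CC z)‾, (CC t)‾, (C u)‾, v‾`.  Chain (the tree's node template in four variables):
`L^ ≅ A′^_{𝔬′}` (`adicCompletionEquivOfIsLocalizationAtMaximal`) `≅ k[z,t,u,v]^_{𝔬}/(u²+v²−h)` (`quotientCompletionEquiv`,
Matsumura 8.11) `≅ k⟦z,t,u,v⟧/(u²+v²−h)` (Mathlib `MvPowerSeries.toAdicCompletionAlgEquiv`) `≅ T_{−h}` (`exists_nestingEquiv`).
[cite: Matsumura1987, Theorem 8.11 (consequence)] -/
theorem exists_ringEquiv_completion (k : Type u) [Field k] (hP : MvPolynomial (Fin 2) k)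
    (h0 : MvPolynomial.constantCoeff hP = 0) (L : Type u) [CommRing L] [IsLocalRing L] [Algebra (KC3Ring k hP) L]
    [(kc3Origin k hP).IsPrime] [IsLocalization.AtPrime L (kc3Origin k hP)] :
    ∃ e : AdicCompletion (maximalIdeal L) L ≃+*
        BranchedCover (PowerSeries (MvPowerSeries (Fin 2) k))
          (PowerSeries.C (-(hP : MvPowerSeries (Fin 2) k)) + PowerSeries.X ^ 2 : PowerSeries (MvPowerSeries (Fin 2) k)) 2,
      ∀ p : MvPolynomial (Fin 4) k, ∀ q : PowerSeries (PowerSeries (MvPowerSeries (Fin 2) k)),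
        (∀ N : MvPowerSeries (Fin 4) k ≃+* PowerSeries (PowerSeries (MvPowerSeries (Fin 2) k)),
            N (MvPowerSeries.X 3) = PowerSeries.X → N (MvPowerSeries.X 2) = PowerSeries.C PowerSeries.X →
            N (MvPowerSeries.X 0) = PowerSeries.C (PowerSeries.C (MvPowerSeries.X 0)) →
            N (MvPowerSeries.X 1) = PowerSeries.C (PowerSeries.C (MvPowerSeries.X 1)) →
            (∀ p : MvPolynomial (Fin 2) k, N ((MvPolynomial.rename zt p : MvPolynomial (Fin 4) k) : MvPowerSeries (Fin 4) k) =
              PowerSeries.C (PowerSeries.C (p : MvPowerSeries (Fin 2) k))) →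
            N (p : MvPowerSeries (Fin 4) k) = q) →
        e (algebraMap L (AdicCompletion (maximalIdeal L) L)
            (algebraMap (KC3Ring k hP) L (Ideal.Quotient.mk _ p))) = Ideal.Quotient.mk _ q := by
  classical
  haveI hmax : (kc3Origin k hP).IsMaximal := kc3Origin_isMaximal h0
  set P := MvPolynomial (Fin 4) k with hPdef
  set J : Ideal P := Ideal.span {kc3Poly k hP} with hJdef
  -- `L^ ≅ A′^_{𝔬′}`
  let e₁ : AdicCompletion (maximalIdeal L) L ≃+* AdicCompletion (kc3Origin k hP) (KC3Ring k hP) :=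
    (adicCompletionEquivOfIsLocalizationAtMaximal (kc3Origin k hP) L).symm
  -- `≅ P^_{𝔬} / J·P^`
  let e₂ : AdicCompletion (kc3Origin k hP) (KC3Ring k hP) ≃+*
      (AdicCompletion (originIdeal k 4) P ⧸ J.map (algebraMap P (AdicCompletion (originIdeal k 4) P))) :=
    (quotientCompletionEquiv (originIdeal k 4) J).symm
  -- `P^_{𝔬} ≅ k⟦z,t,u,v⟧`
  have hI : MvPolynomial.idealOfVars (Fin 4) k = originIdeal k 4 := (originIdeal_eq_span k 4).symm
  let eP : AdicCompletion (originIdeal k 4) P ≃+* MvPowerSeries (Fin 4) k :=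
    ((MvPowerSeries.toAdicCompletionAlgEquiv (Fin 4) k).toRingEquiv.trans
      (adicCompletionEquivOfLE (MvPolynomial.idealOfVars (Fin 4) k) (originIdeal k 4) (e := 1)
        (by rw [pow_one, hI]) hI.le)).symm
  have heP : ∀ p : P, eP (AdicCompletion.of (originIdeal k 4) P p) = (p : MvPowerSeries (Fin 4) k) := fun p => by
    rw [RingEquiv.symm_apply_eq, RingEquiv.trans_apply]
    change _ = adicCompletionEquivOfLE _ _ _ _ (MvPowerSeries.toAdicCompletionAlgEquiv (Fin 4) k p)
    rw [MvPowerSeries.toAdicCompletionAlgEquiv_apply, MvPowerSeries.toAdicCompletion_coe, adicCompletionEquivOfLE_of]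
  -- `≅ k⟦z,t,u,v⟧ / (u² + v² − h)`
  have hJ₃ : Ideal.span {(kc3Poly k hP : MvPowerSeries (Fin 4) k)} =
      (J.map (algebraMap P (AdicCompletion (originIdeal k 4) P))).map (eP : _ →+* MvPowerSeries (Fin 4) k) := by
    rw [hJdef, Ideal.map_span, Set.image_singleton, Ideal.map_span, Set.image_singleton, AdicCompletion.algebraMap_apply,
      Algebra.algebraMap_self, RingHom.id_apply, RingHom.coe_coe, heP]
  let e₃ := Ideal.quotientEquiv _ _ eP hJ₃
  -- `≅ T_{−h}`
  obtain ⟨N, hN3, hN2, hN0, hN1, hNp⟩ := exists_nestingEquiv k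
  have hJ₄ : Ideal.span {(PowerSeries.C (PowerSeries.C (-(hP : MvPowerSeries (Fin 2) k)) + PowerSeries.X ^ 2) + PowerSeries.X ^ 2 :
        PowerSeries (PowerSeries (MvPowerSeries (Fin 2) k)))} =
      (Ideal.span {(kc3Poly k hP : MvPowerSeries (Fin 4) k)}).map (N : _ →+* _) := by
    rw [Ideal.map_span, Set.image_singleton, RingHom.coe_coe, nesting_kc3Poly N hN3 hN2 hNp]
  let e₄ := Ideal.quotientEquiv _ _ N hJ₄
  refine ⟨((e₁.trans e₂).trans e₃).trans e₄, fun p q hq => ?_⟩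
  have hq' : N (p : MvPowerSeries (Fin 4) k) = q := hq N hN3 hN2 hN0 hN1 hNp
  rw [RingEquiv.trans_apply, RingEquiv.trans_apply, RingEquiv.trans_apply]
  have h1 : e₁ (algebraMap L (AdicCompletion (maximalIdeal L) L) (algebraMap (KC3Ring k hP) L (Ideal.Quotient.mk _ p))) =
      AdicCompletion.of (kc3Origin k hP) (KC3Ring k hP) (Ideal.Quotient.mk _ p) := by
    change (adicCompletionEquivOfIsLocalizationAtMaximal (kc3Origin k hP) L).symm _ = _
    rw [RingEquiv.symm_apply_eq, adicCompletionEquivOfIsLocalizationAtMaximal_of, AdicCompletion.algebraMap_apply,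
      Algebra.algebraMap_self, RingHom.id_apply]
  have h2 : e₂ (AdicCompletion.of (kc3Origin k hP) (KC3Ring k hP) (Ideal.Quotient.mk _ p)) =
      Ideal.Quotient.mk _ (AdicCompletion.of (originIdeal k 4) P p) := by
    change (quotientCompletionEquiv (originIdeal k 4) J).symm _ = _
    rw [RingEquiv.symm_apply_eq, quotientCompletionEquiv_mk_of]
    rfl
  rw [h1, h2]
  change e₄ (Ideal.Quotient.mk _ (eP (AdicCompletion.of (originIdeal k 4) P p))) = _
  rw [heP]
  change Ideal.Quotient.mk _ (N (p : MvPowerSeries (Fin 4) k)) = _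
  rw [hq']

/-- The four generator values of the K2c isomorphism: `z ↦ (CC z)‾`, `t ↦ (CC t)‾`, `u ↦ (C u)‾`, `v ↦ v‾`, and the square
classes `z² ↦ (CC z²)‾`, `zt ↦ (CC zt)‾`, `t² ↦ (CC t²)‾`. [folklore] -/
theorem exists_ringEquiv_completion_values (k : Type u) [Field k] (hP : MvPolynomial (Fin 2) k)
    (h0 : MvPolynomial.constantCoeff hP = 0) (L : Type u) [CommRing L] [IsLocalRing L] [Algebra (KC3Ring k hP) L]
    [(kc3Origin k hP).IsPrime] [IsLocalization.AtPrime L (kc3Origin k hP)] :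
    ∃ e : AdicCompletion (maximalIdeal L) L ≃+*
        BranchedCover (PowerSeries (MvPowerSeries (Fin 2) k))
          (PowerSeries.C (-(hP : MvPowerSeries (Fin 2) k)) + PowerSeries.X ^ 2 : PowerSeries (MvPowerSeries (Fin 2) k)) 2,
      e (algebraMap L _ (algebraMap (KC3Ring k hP) L (Ideal.Quotient.mk _ (MvPolynomial.X 3)))) =
          Ideal.Quotient.mk _ PowerSeries.X ∧
      e (algebraMap L _ (algebraMap (KC3Ring k hP) L (Ideal.Quotient.mk _ (MvPolynomial.X 2)))) =
          Ideal.Quotient.mk _ (PowerSeries.C PowerSeries.X) ∧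
      e (algebraMap L _ (algebraMap (KC3Ring k hP) L (Ideal.Quotient.mk _ (MvPolynomial.X 0 ^ 2)))) =
          Ideal.Quotient.mk _ (PowerSeries.C (PowerSeries.C (MvPowerSeries.X 0 ^ 2))) ∧
      e (algebraMap L _ (algebraMap (KC3Ring k hP) L (Ideal.Quotient.mk _ (MvPolynomial.X 0 * MvPolynomial.X 1)))) =
          Ideal.Quotient.mk _ (PowerSeries.C (PowerSeries.C (MvPowerSeries.X 0 * MvPowerSeries.X 1))) ∧
      e (algebraMap L _ (algebraMap (KC3Ring k hP) L (Ideal.Quotient.mk _ (MvPolynomial.X 1 ^ 2)))) =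
          Ideal.Quotient.mk _ (PowerSeries.C (PowerSeries.C (MvPowerSeries.X 1 ^ 2))) := by
  obtain ⟨e, he⟩ := exists_ringEquiv_completion k hP h0 L
  refine ⟨e, he _ _ ?_, he _ _ ?_, he _ _ ?_, he _ _ ?_, he _ _ ?_⟩ <;> intro N hN3 hN2 hN0 hN1 _
  · rw [MvPolynomial.coe_X, hN3]
  · rw [MvPolynomial.coe_X, hN2]
  · rw [MvPolynomial.coe_pow, MvPolynomial.coe_X, map_pow, hN0, map_pow, map_pow]
  · rw [MvPolynomial.coe_mul, MvPolynomial.coe_X, MvPolynomial.coe_X, map_mul, hN0, hN1, map_mul, map_mul]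
  · rw [MvPolynomial.coe_pow, MvPolynomial.coe_X, map_pow, hN1, map_pow, map_pow]

/-! ## K2-LOWER at the algebraic local ring: faithfully flat descent from the completion -/

/-- The coerced plane-curve series `↑hP` lies in the maximal ideal of `k⟦z,t⟧` when `hP(0) = 0`. [folklore] -/
theorem constantCoeff_coe_eq_zero {k : Type u} [Field k] {hP : MvPolynomial (Fin 2) k}
    (h0 : MvPolynomial.constantCoeff hP = 0) : MvPowerSeries.constantCoeff (hP : MvPowerSeries (Fin 2) k) = 0 := by
  rw [← MvPowerSeries.coeff_zero_eq_constantCoeff_apply, MvPolynomial.coeff_coe, ← MvPolynomial.constantCoeff_eq]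
  exact h0

/-- **K2-LOWER AT THE ALGEBRAIC LOCAL RING [OURS · K-C3 §H2L]:** for a field `k` with `char k ≠ 2`, a plane-curve polynomial
`0 ≠ hP ∈ k[z,t]` with `hP(0) = 0`, and ANY local ring `L` of the threefold `A′ = k[z,t,u,v]/(u² + v² − hP)` at the origin:
IF `ca(k⟦z,t⟧/(h)) = (z,t)²·(k⟦z,t⟧/(h))` (`hca`, `h = ↑hP`; for `hP = z³ + t⁴`: [Esentepe2020, Thm. 4.4] + the conductor of `⟨3,4⟩`,
K2b) THEN, modulo [Esentepe2020, Thm. 5.4] (`hE`), **`(u, v, z², zt, t²)·L ⊆ ca(L)`**.  Proof: `L → L^` is faithfully flat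
(`faithfullyFlat_adicCompletion`), so `ca(L^) ∩ L ⊆ ca(L)` (`comap_cohomologyAnnihilator_le_of_faithfullyFlat'`, p512917 — no
named fact); `L^ ≅ T_{−h}` (`exists_ringEquiv_completion_values`) carries the five generators to `ū, v̄, (CC z²)‾, (CC zt)‾, (CC t²)‾`,
which lie in `ca(T_{−h}) = (v̄, ū) ⊔ (z̄², z̄t̄, t̄²)` (part 4b).  Under `x = u + iv`, `y = u − iv` this is the lower bound
`I·T₀ ⊆ ca(T₀)`, `I = (x, y, z², zt, t²)`, of the K-C3 centre. [cite: Esentepe2020, Theorems 4.4 and 5.4 (consequence)] -/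
theorem span_le_cohomologyAnnihilator_of_isLocalization
    (hE : doubleBranchedCover_map_cohomologyAnnihilator_eq.{u}) (k : Type u) [Field k] (hchar : ringChar k ≠ 2)
    (hP : MvPolynomial (Fin 2) k) (h0 : MvPolynomial.constantCoeff hP = 0) (hP0 : hP ≠ 0)
    (hca : cohomologyAnnihilator (MvPowerSeries (Fin 2) k ⧸ Ideal.span {(hP : MvPowerSeries (Fin 2) k)}) =
      ((Ideal.span {(MvPowerSeries.X 0 : MvPowerSeries (Fin 2) k), MvPowerSeries.X 1}) ^ 2).map
        (Ideal.Quotient.mk (Ideal.span {(hP : MvPowerSeries (Fin 2) k)})))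
    (L : Type u) [CommRing L] [IsLocalRing L] [Algebra (KC3Ring k hP) L] [(kc3Origin k hP).IsPrime]
    [IsLocalization.AtPrime L (kc3Origin k hP)] :
    Ideal.span {algebraMap (KC3Ring k hP) L (Ideal.Quotient.mk _ (MvPolynomial.X 2)),
        algebraMap (KC3Ring k hP) L (Ideal.Quotient.mk _ (MvPolynomial.X 3)),
        algebraMap (KC3Ring k hP) L (Ideal.Quotient.mk _ (MvPolynomial.X 0 ^ 2)),
        algebraMap (KC3Ring k hP) L (Ideal.Quotient.mk _ (MvPolynomial.X 0 * MvPolynomial.X 1)),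
        algebraMap (KC3Ring k hP) L (Ideal.Quotient.mk _ (MvPolynomial.X 1 ^ 2))} ≤
      cohomologyAnnihilator L := by
  haveI : IsNoetherianRing L :=
    IsLocalization.isNoetherianRing (kc3Origin k hP).primeCompl L inferInstance
  haveI := faithfullyFlat_adicCompletion L
  obtain ⟨e, h3, h2, h00, h01, h11⟩ := exists_ringEquiv_completion_values k hP h0 L
  have hT := cohomologyAnnihilator_doubleDoubleCover_planeCurve_neg_eq_span_sup_span hE k hchar
    (hP : MvPowerSeries (Fin 2) k) (constantCoeff_coe_eq_zero h0)
    (fun h => hP0 (MvPolynomial.coe_eq_zero_iff.mp h)) hca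
  -- descent along `L → L^ ≅ T_{−h}`
  have key : ∀ x : L, e (algebraMap L (AdicCompletion (maximalIdeal L) L) x) ∈
      cohomologyAnnihilator (BranchedCover (PowerSeries (MvPowerSeries (Fin 2) k))
        (PowerSeries.C (-(hP : MvPowerSeries (Fin 2) k)) + PowerSeries.X ^ 2 : PowerSeries (MvPowerSeries (Fin 2) k)) 2) →
      x ∈ cohomologyAnnihilator L := fun x hx => by
    apply comap_cohomologyAnnihilator_le_of_faithfullyFlat' (S := AdicCompletion (maximalIdeal L) L)
    rw [Ideal.mem_comap, cohomologyAnnihilator_eq_comap_ringEquiv e, Ideal.mem_comap]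
    exact hx
  rw [Ideal.span_le]
  rintro x hx
  simp only [Set.mem_insert_iff, Set.mem_singleton_iff] at hx
  rw [SetLike.mem_coe]
  rcases hx with rfl | rfl | rfl | rfl | rfl
  · exact key _ (by rw [h2, hT]; exact Ideal.mem_sup_left (Ideal.subset_span (by simp)))
  · exact key _ (by rw [h3, hT]; exact Ideal.mem_sup_left (Ideal.subset_span (by simp)))
  · exact key _ (by rw [h00, hT]; exact Ideal.mem_sup_right (Ideal.subset_span (by simp)))
  · exact key _ (by rw [h01, hT]; exact Ideal.mem_sup_right (Ideal.subset_span (by simp)))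
  · exact key _ (by rw [h11, hT]; exact Ideal.mem_sup_right (Ideal.subset_span (by simp)))

/-- The same for the STANDARD local ring `Localization.AtPrime 𝔬′` of `A′` at the origin (instance of the previous theorem).
[cite: Esentepe2020, Theorems 4.4 and 5.4 (consequence)] -/
theorem span_le_cohomologyAnnihilator_localizationAtPrime
    (hE : doubleBranchedCover_map_cohomologyAnnihilator_eq.{u}) (k : Type u) [Field k] (hchar : ringChar k ≠ 2)
    (hP : MvPolynomial (Fin 2) k) (h0 : MvPolynomial.constantCoeff hP = 0) (hP0 : hP ≠ 0)
    (hca : cohomologyAnnihilator (MvPowerSeries (Fin 2) k ⧸ Ideal.span {(hP : MvPowerSeries (Fin 2) k)}) =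
      ((Ideal.span {(MvPowerSeries.X 0 : MvPowerSeries (Fin 2) k), MvPowerSeries.X 1}) ^ 2).map
        (Ideal.Quotient.mk (Ideal.span {(hP : MvPowerSeries (Fin 2) k)}))) :
    haveI := (kc3Origin_isMaximal (k := k) (hP := hP) h0).isPrime
    Ideal.span {algebraMap (KC3Ring k hP) (Localization.AtPrime (kc3Origin k hP)) (Ideal.Quotient.mk _ (MvPolynomial.X 2)),
        algebraMap (KC3Ring k hP) (Localization.AtPrime (kc3Origin k hP)) (Ideal.Quotient.mk _ (MvPolynomial.X 3)),
        algebraMap (KC3Ring k hP) (Localization.AtPrime (kc3Origin k hP)) (Ideal.Quotient.mk _ (MvPolynomial.X 0 ^ 2)),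
        algebraMap (KC3Ring k hP) (Localization.AtPrime (kc3Origin k hP))
          (Ideal.Quotient.mk _ (MvPolynomial.X 0 * MvPolynomial.X 1)),
        algebraMap (KC3Ring k hP) (Localization.AtPrime (kc3Origin k hP)) (Ideal.Quotient.mk _ (MvPolynomial.X 1 ^ 2))} ≤
      cohomologyAnnihilator (Localization.AtPrime (kc3Origin k hP)) := by
  haveI := (kc3Origin_isMaximal (k := k) (hP := hP) h0).isPrime
  exact span_le_cohomologyAnnihilator_of_isLocalization hE k hchar hP h0 hP0 hca (Localization.AtPrime (kc3Origin k hP))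

end Summit.ResolutionOfSingularities.ResolutionOfSingularities.Theorems.HomologicalConductor.PersistenceKC3Completion

end
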